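import Literature.AlgebraicGeometry.HodgeTheory.BettiUniverseKunnethHodge
import Literature.AlgebraicGeometry.HodgeTheory.BettiKunnethHodgeClassesHodgeMorphisms
import Literature.AlgebraicGeometry.HodgeTheory.BettiSelfFibrePowers
import Literature.AlgebraicGeometry.HodgeTheory.BettiPicardNumberOfProducts
import Literature.AlgebraicGeometry.HodgeTheory.BettiPicardNumberProductsAbelianVarieties
import Literature.AlgebraicGeometry.Motives.HodgeStructureHomSpacesFiniteDirectSum
import Literature.AlgebraicGeometry.Motives.HodgeStructurePicardNumberPowers
import Literature.AlgebraicGeometry.Motives.HodgeStructureTensorConstraints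
import Literature.AlgebraicGeometry.Motives.HodgeStructureRankOne
import Literature.AlgebraicGeometry.Motives.HodgeTensorFactsHolds
import HarnessLib

/-!
# `H¹(Y × Z) = pr₁^* H¹(Y) ⊕ pr₂^* H¹(Z)` as `ℚ`-Hodge structures, counted through morphism spaces: `dim Hom_HS(H₀, H¹(Y × Z)) = dim Hom_HS(H₀, H¹(Y)) + dim Hom_HS(H₀, H¹(Z))`
# (both sides), the Picard number of a triple product and of the self powers `ρ(X^{m+1}) = (m+1)ρ(X) + C(m+1, 2)·dim End_HS(H¹(X))`, and for abelian varieties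
# `ρ(A^{m+1}) = (m+1)ρ(A) + C(m+1, 2)·rk End(A)`, `ρ(E^{m+1}) ∈ [C(m+2, 2), (m+1)²]` (Voisin I Thm. 11.38–11.40; Hulek–Laface Prop. 2.2, Cor. 2.3, Prop. 2.4 = Murty Lemma 3.3)

Family `hodge`, lane `lit-hodgefound` (Track 2 foundations library; Layers A1/A2/A4), layer `Literature/AlgebraicGeometry/HodgeTheory`.  THEOREMS ONLY (no definition,
no named fact, no instance; D-0026 net debt `0`; the `[HodgeTensorFacts]` hypothesis appears only in §1, whose statements name the tensor Hodge structures `kunnethSummand` — everywhere else the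
tree's theorem `hodgeTensorFacts_holds` is supplied inside the proofs).  Sequel of the
seat's g27-#7 (`BettiKunnethHodgeClassesHodgeMorphisms`: `ρ(Y × Z) = ρ(Y) + ρ(Z) + dim_ℚ Hom_HS(H¹(Y), H¹(Z))`), g28-#5 (`BettiPicardNumberProductsAbelianVarieties`: Riemann's theorem on the
lane's carriers `dim_ℚ Hom_HS(H¹(A), H¹(A')) = rk_ℤ Hom(A', A)`) and the lane's Künneth isomorphism of Hodge structures (`BettiUniverseKunnethHodge`: `⊕_{i+j=k} Hⁱ(Y) ⊗ Hʲ(Z) ≅ Hᵏ(Y × Z)`,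
`kunnethHodgeHom`, bijective).  In degree one the Künneth decomposition has the two END PIECES `H¹(Y) ⊗ H⁰(Z) = pr₁^* H¹(Y)` and `H⁰(Y) ⊗ H¹(Z) = pr₂^* H¹(Z)` only, and `H⁰ = ℚ(0)` is the unit
(one-dimensional of type `(0,0)`): so **`H¹(Y × Z) ≅ H¹(Y) ⊕ H¹(Z)`** in `ℚ`-Hodge structures.  This file proves the isomorphisms `Hᵏ(Y) → Hᵏ(Y) ⊗ H⁰(Z)`, `Hᵏ(Z) → H⁰(Y) ⊗ Hᵏ(Z)` of Hodge
structures (the unitors of the tensor category, Deligne–Milne Prop. 1.3, composed with `ℚ(0) ≅ H⁰`), and COUNTS the decomposition through the morphism spaces into / out of an arbitrary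
finite-dimensional `ℚ`-Hodge structure `H₀` of weight one (the tree's additivity of `Hom_HS` over finite direct sums, p34's `finrank_hom_pi_right_eq_sum` / `finrank_hom_pi_eq_sum`):
**`dim Hom_HS(H₀, H¹(Y × Z)) = dim Hom_HS(H₀, H¹(Y)) + dim Hom_HS(H₀, H¹(Z))`** and **`dim Hom_HS(H¹(Y × Z), H₀) = dim Hom_HS(H¹(Y), H₀) + dim Hom_HS(H¹(Z), H₀)`**.  Consequences: the Picard
number of a TRIPLE product **`ρ(Y × Z × W) = ρ(Y) + ρ(Z) + ρ(W) + dim Hom_HS(H¹Y, H¹Z) + dim Hom_HS(H¹Y, H¹W) + dim Hom_HS(H¹Z, H¹W)`**, of the SELF POWERS **`ρ(X^{m+1}) = (m+1)·ρ(X) +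
C(m+1, 2)·dim End_HS(H¹(X))`** (Murty's Lemma 3.3 / Hulek–Laface Prop. 2.4 in uniform form, for every smooth projective `X`; curves: `ρ(C^{m+1}) = (m+1) + C(m+1, 2)·dim End_HS(H¹(C))`), and for
abelian varieties, through Riemann's theorem, **`ρ(A^{m+1}) = (m+1)·ρ(A) + C(m+1, 2)·rk_ℤ End(A)`**, `ρ(A × A' × A'') = Σ ρ + Σ rk Hom`, `rk Hom(B, A × A') = rk Hom(B, A) + rk Hom(B, A')` (read
Hodge-theoretically), and for an elliptic curve **`C(m+2, 2) ≤ ρ(E^{m+1}) ≤ (m+1)²`** (the printed `ρ(E^k) = k(k+1)/2` without CM, `k²` with CM, as the two ends of `1 ≤ rk End(E) ≤ 2`).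

THE PRINTS.  C. Voisin (2002) [VoisinHodgeI2002] §11.3.3 Thm. 11.38 (Künneth), Def. 11.39, Thm. 11.40 («`H^k(X) ⊗ H^l(Y)` is a sub-Hodge structure of `H^{k+l}(X × Y)`, isomorphic to the tensor
product of the Hodge structures»), Lemma 11.41 and p. 287; §7.3.2 (pull-backs are morphisms of Hodge structures).  P. Deligne (1971) [DeligneHodgeII1971] 2.1 (the abelian category of Hodge
structures; direct sums), 1.1.12, 2.1.13–2.1.14 (`ℚ(0)`, `H ⊗ ℚ(0) = H`).  P. Deligne, J. S. Milne (1982) [DeligneMilne1982Tannakian] §1 Prop. 1.3 (unit constraints `ℓ_X`, `r_X`), II §6 Thm. 6.20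
(Riemann).  K. Hulek, R. Laface (2019) [HulekLaface2019PicardNumbersAV] §2.1 Prop. 2.2 («`NS(A₁ × A₂) ≅ NS(A₁) ⊕ NS(A₂) ⊕ Hom(A₁, A₂)`»), Cor. 2.3, §2.2 Prop. 2.4 (= V. K. Murty, *Exceptional Hodge
classes on certain abelian varieties*, Math. Ann. 268 (1984), Lemma 3.3) and the display «`ρ(E^k) = ½k(k+1)` (`E` has no CM), `k²` (`E` has CM)».  D. Arapura (2012) [Arapura2012] §11.1
Example 11.1.2 (PDF p. 174).  H. Lange (2023) [Lange2023AbelianVarietiesComplex] §2.4.4 Cor. 2.4.26 (proof: `Hom` is additive).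

THE OBJECTS (all the tree's).  `Y Z W X : SchemeOver ℂ` smooth projective (`hY : IsSmoothProjective m Y`, …), `Y ⊗ Z = Y ×_ℂ Z`, `powObj X m = X^{m+1}` (`Motives/FibrePowerFan`), `Hᵏ(X) =
BettiUniverse.hodge hHD hX k`, the Künneth summands `BettiUniverse.kunnethSummand hHD hY hZ k ij` (`Hⁱ(Y) ⊗ Hʲ(Z)`, `i + j = k`) and the bijective morphism `BettiUniverse.kunnethHodgeHom`;
`H₀ : HodgeStructure V₀ k` any `ℚ`-Hodge structure on a finite-dimensional carrier; `ρ(X) = dim_ℚ Hdg¹(H²(X))`; `A A' B : Motives.AbelianVariety ℂ`, `A.prod A'` (`(A.prod A').X = A.X ⊗ A'.X`).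

WHAT IS PROVED.
* §1 THE END PIECES: `Hᵏ(Y) ≅ Hᵏ(Y) ⊗ H⁰(Z)` and `Hᵏ(Z) ≅ H⁰(Y) ⊗ Hᵏ(Z)` by bijective morphisms of Hodge structures (`BettiUniverse.exists_hom_hodge_kunnethSummandFst_bijective`, `…Snd…`; private:
  `ℚ(0) ≅ H⁰(Y)`), hence `dim Hom_HS(H₀, Hᵏ(Y) ⊗ H⁰(Z)) = dim Hom_HS(H₀, Hᵏ(Y))` etc. on both sides (`BettiUniverse.finrank_hom_right_kunnethSummandFst`, `_left_`, `…Snd`).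
* §2 DEGREE ONE: **`dim Hom_HS(H₀, H¹(Y × Z)) = dim Hom_HS(H₀, H¹(Y)) + dim Hom_HS(H₀, H¹(Z))`** (`BettiUniverse.finrank_hom_right_hodge_one_tensor`) and **`dim Hom_HS(H¹(Y × Z), H₀) =
  dim Hom_HS(H¹(Y), H₀) + dim Hom_HS(H¹(Z), H₀)`** (`BettiUniverse.finrank_hom_left_hodge_one_tensor`), for every finite-dimensional `H₀` of weight one; in particular for `H₀ = H¹(W)`.
* §3 PICARD NUMBERS: **`ρ((Y × Z) × W) = ρ(Y) + ρ(Z) + ρ(W) + dim Hom_HS(H¹Y, H¹Z) + dim Hom_HS(H¹Y, H¹W) + dim Hom_HS(H¹Z, H¹W)`** (`BettiUniverse.picardNumber_tensor_tensor`); powers: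
  `dim Hom_HS(H₀, H¹(X^{m+1})) = (m+1)·dim Hom_HS(H₀, H¹(X))` (both sides; `dim End_HS(H¹(X^{m+1})) = (m+1)²·dim End_HS(H¹(X))`), **`ρ(X^{m+1}) = (m+1)·ρ(X) + C(m+1, 2)·dim End_HS(H¹(X))`**
  (`BettiUniverse.picardNumber_powObj`, any smooth-projective witness of the power), `ρ(C^{m+1}) = (m+1) + C(m+1, 2)·dim End_HS(H¹(C))` for curves.
* §4 ABELIAN VARIETIES (Riemann, g28-#5): `rk Hom(B, A × A') = rk Hom(B, A) + rk Hom(B, A')` and `rk Hom(A × A', B) = rk Hom(A, B) + rk Hom(A', B)` recovered Hodge-theoretically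
  (`AbelianVariety.finrank_hom_prod_right_eq_add`, `_left_`); **`ρ(A × A' × A'') = ρ(A) + ρ(A') + ρ(A'') + rk Hom(A', A) + rk Hom(A'', A) + rk Hom(A'', A')`**; **`ρ(A^{m+1}) = (m+1)·ρ(A) +
  C(m+1, 2)·rk End(A)`** (`BettiUniverse.picardNumber_powObj_abelianVariety`); elliptic curves (`dim E = 1`): `ρ(E^{m+1}) = (m+1) + C(m+1, 2)·rk End(E)` and **`C(m+2, 2) ≤ ρ(E^{m+1}) ≤ (m+1)²`**.

DEVIATIONS / SCOPE.  The direct-sum decomposition is established as two bijective morphisms onto the Künneth end pieces plus the tree's bijective `kunnethHodgeHom`, and used through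
dimension counts of morphism spaces; an explicit morphism `H¹(Y) ⊕ H¹(Z) → H¹(Y × Z)` is not packaged as a definition (no `def` in this file).  Murty's type-by-type VALUES of `rk End(A)` are not
reproduced (the tree's `Motives/HodgeStructurePicardNumberPowers` has the abstract direct-sum form).

## References
* [VoisinHodgeI2002] C. Voisin, *Hodge Theory and Complex Algebraic Geometry I* (2002) — §11.3.3 Thm. 11.38, Def. 11.39, Thm. 11.40, Lemma 11.41 (pp. 285–287); §7.3.2.
* [DeligneHodgeII1971] P. Deligne, *Théorie de Hodge II* (1971) — 2.1; 1.1.12; 2.1.13–2.1.14.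
* [DeligneMilne1982Tannakian] P. Deligne, J. S. Milne, *Tannakian Categories*, LNM 900 (1982) — §1 Prop. 1.3; II §6 Thm. 6.20.
* [HulekLaface2019PicardNumbersAV] K. Hulek, R. Laface, *On the Picard numbers of abelian varieties* (2019) — §2.1 Prop. 2.2, Cor. 2.3; §2.2 Prop. 2.4 (= Murty 1984 Lemma 3.3), Cor. 2.5.
* [Arapura2012] D. Arapura, *Algebraic Geometry over the Complex Numbers* (2012) — §11.1 Example 11.1.2 (PDF p. 174).
* [Lange2023AbelianVarietiesComplex] H. Lange, *Abelian Varieties over the Complex Numbers* (2023) — §2.4.4 Cor. 2.4.26 (proof).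

## Provenance
Lane `lit-hodgefound` (Hodge path, Track 2), prover seat `lit-hodgefound-p29` (generation 28), self-proposed row g28-#6 (gen-27 HANDOFF free pointers (c)/(d): three factors and powers; junction of
g27-#7, g28-#5 with the lane's `BettiUniverseKunnethHodge` and p34's `HodgeStructureHomSpacesFiniteDirectSum` / `HodgeStructurePicardNumberPowers`).
-/

noncomputable section

open scoped TensorProduct
open CategoryTheory MonoidalCategory Module Finset
open Literature.AlgebraicTopology.SingularHomology
open Literature.Geometry.Kaehler

namespace Literature.AlgebraicGeometry.HodgeTheory

open Literature.AlgebraicGeometry.Motives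
open Literature.AlgebraicGeometry.Motives.HodgeStructure

variable {m n l d : ℕ} {X Y Z W : SchemeOver ℂ}

/-! ### §1 The unit `ℚ(0) ≅ H⁰` and the end pieces `Hᵏ(Y) ⊗ H⁰(Z) ≅ Hᵏ(Y)`, `H⁰(Y) ⊗ Hᵏ(Z) ≅ Hᵏ(Z)` -/

/-- `Fᵖ H⁰(Y) = everything` for `p ≤ 0` (`H⁰` is one-dimensional of type `(0,0)`). [cite: VoisinHodgeI2002, §11.3.3 p. 287] -/
private theorem hodge_zero_F_eq_top (hHD : exists_isReal_hodgeModel) (hY : IsSmoothProjective m Y) {p : ℤ} (hp : p ≤ 0) : (BettiUniverse.hodge hHD hY 0).F p = ⊤ := by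
  have h0 : (BettiUniverse.hodge hHD hY 0).F 0 = ⊤ :=
    (BettiUniverse.hodge hHD hY 0).F_eq_top_of_finrank_eq_one (k := 0) (by norm_num) (BettiUniverse.finrank_bettiCohomology_zero hY)
  exact eq_top_iff.2 (h0.ge.trans ((BettiUniverse.hodge hHD hY 0).antitone_F hp))

/-- `ℚ(0) ≅ H⁰(Y)`: for a non-zero `e ∈ H⁰(Y(ℂ); ℚ) ≅ ℚ`, `q ↦ q·e` is a bijective morphism of Hodge structures `ℚ(0) → H⁰(Y)`. [cite: DeligneHodgeII1971, 2.1.13] [cite: VoisinHodgeI2002, §11.3.3 p. 287] -/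
private theorem exists_hom_ofWeightZero_hodge_zero_bijective (hHD : exists_isReal_hodgeModel) (hY : IsSmoothProjective m Y) :
    ∃ ι : HodgeStructure.Hom (HodgeStructure.ofWeightZero ℚ) (BettiUniverse.hodge hHD hY 0), Function.Bijective ι.toLinearMap := by
  haveI := BettiUniverse.finite hY 0
  have h1 := BettiUniverse.finrank_bettiCohomology_zero hY
  obtain ⟨e, he⟩ := (Module.finrank_pos_iff_exists_ne_zero (R := ℚ) (M := bettiCohomology Y 0)).1 (by omega)
  let ι : HodgeStructure.Hom (HodgeStructure.ofWeightZero ℚ) (BettiUniverse.hodge hHD hY 0) :=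
    { toLinearMap := LinearMap.toSpanSingleton ℚ (bettiCohomology Y 0) e
      map_F_le := fun p ↦ by
        by_cases hp : p ≤ 0
        · rw [hodge_zero_F_eq_top hHD hY hp]
          exact le_top
        · rw [HodgeStructure.ofWeightZero_F, HodgeStructure.pureFiltration_of_lt (not_le.1 hp), Submodule.map_bot]
          exact bot_le }
  have hinj : Function.Injective ι.toLinearMap := LinearMap.ker_eq_bot.1 (LinearMap.ker_toSpanSingleton ℚ he)
  exact ⟨ι, hinj, (LinearMap.injective_iff_surjective_of_finrank_eq_finrank (by rw [Module.finrank_self, h1])).1 hinj⟩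

/-- **`Hᵏ(Y) ≅ Hᵏ(Y) ⊗ H⁰(Z)`**, the Künneth end piece `pr₁^* Hᵏ(Y)`: `y ↦ y ⊗ e` (`e ≠ 0` in `H⁰(Z) ≅ ℚ(0)`) is a bijective morphism of Hodge structures onto the summand of bidegree `(k, 0)` — the right
unitor `r : H → H ⊗ ℚ(0)` (Deligne–Milne Prop. 1.3, the tree's `Hom.tensorRidSymm`) followed by `id ⊗ (ℚ(0) ≅ H⁰(Z))`. [cite: VoisinHodgeI2002, §11.3.3 Thm. 11.40 and p. 287]
[cite: DeligneMilne1982Tannakian, §1 Prop. 1.3] [cite: DeligneHodgeII1971, 2.1.13–2.1.14] -/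
theorem BettiUniverse.exists_hom_hodge_kunnethSummandFst_bijective [HodgeTensorFacts.{0, 0}] (hHD : exists_isReal_hodgeModel) (hY : IsSmoothProjective m Y) (hZ : IsSmoothProjective n Z) (k : ℕ)
    (h : (k, (0 : ℕ)) ∈ antidiagonal k) :
    ∃ Φ : HodgeStructure.Hom (BettiUniverse.hodge hHD hY k) (BettiUniverse.kunnethSummand hHD hY hZ k ⟨(k, 0), h⟩), Function.Bijective Φ.toLinearMap := by
  obtain ⟨ι, hι⟩ := exists_hom_ofWeightZero_hodge_zero_bijective hHD hZ
  set C := (HodgeStructure.Hom.tensorMap (HodgeStructure.Hom.id (BettiUniverse.hodge hHD hY k)) ι).comp (HodgeStructure.Hom.tensorRidSymm (BettiUniverse.hodge hHD hY k)) with hC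
  set E : bettiCohomology Y k ≃ₗ[ℚ] bettiCohomology Y k ⊗[ℚ] bettiCohomology Z 0 :=
    (TensorProduct.rid ℚ (bettiCohomology Y k)).symm ≪≫ₗ TensorProduct.congr (LinearEquiv.refl ℚ _) (LinearEquiv.ofBijective ι.toLinearMap hι) with hE
  have hCE : ⇑C.toLinearMap = ⇑E := by
    funext y
    rw [hC, hE, HodgeStructure.Hom.comp_toLinearMap, LinearMap.comp_apply, HodgeStructure.Hom.tensorRidSymm_toLinearMap, HodgeStructure.Hom.tensorMap_toLinearMap,
      HodgeStructure.Hom.id_toLinearMap, LinearEquiv.coe_toLinearMap, TensorProduct.rid_symm_apply, TensorProduct.map_tmul, LinearEquiv.trans_apply, TensorProduct.rid_symm_apply,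
      TensorProduct.congr_tmul, LinearEquiv.refl_apply, LinearEquiv.ofBijective_apply, LinearMap.id_apply]
  refine ⟨{ toLinearMap := C.toLinearMap, map_F_le := fun p ↦ C.map_F_le p }, ?_⟩
  show Function.Bijective ⇑C.toLinearMap
  rw [hCE]
  exact E.bijective

/-- **`Hᵏ(Z) ≅ H⁰(Y) ⊗ Hᵏ(Z)`**, the Künneth end piece `pr₂^* Hᵏ(Z)`: `z ↦ e ⊗ z` is a bijective morphism of Hodge structures onto the summand of bidegree `(0, k)` (the left unitor `ℓ : H → ℚ(0) ⊗ H`,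
the tree's `Hom.tensorLidSymm`, followed by `(ℚ(0) ≅ H⁰(Y)) ⊗ id`). [cite: VoisinHodgeI2002, §11.3.3 Thm. 11.40 and p. 287] [cite: DeligneMilne1982Tannakian, §1 Prop. 1.3] [cite: DeligneHodgeII1971, 2.1.13–2.1.14] -/
theorem BettiUniverse.exists_hom_hodge_kunnethSummandSnd_bijective [HodgeTensorFacts.{0, 0}] (hHD : exists_isReal_hodgeModel) (hY : IsSmoothProjective m Y) (hZ : IsSmoothProjective n Z) (k : ℕ)
    (h : ((0 : ℕ), k) ∈ antidiagonal k) :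
    ∃ Φ : HodgeStructure.Hom (BettiUniverse.hodge hHD hZ k) (BettiUniverse.kunnethSummand hHD hY hZ k ⟨(0, k), h⟩), Function.Bijective Φ.toLinearMap := by
  obtain ⟨ι, hι⟩ := exists_hom_ofWeightZero_hodge_zero_bijective hHD hY
  set C := (HodgeStructure.Hom.tensorMap ι (HodgeStructure.Hom.id (BettiUniverse.hodge hHD hZ k))).comp (HodgeStructure.Hom.tensorLidSymm (BettiUniverse.hodge hHD hZ k)) with hC
  set E : bettiCohomology Z k ≃ₗ[ℚ] bettiCohomology Y 0 ⊗[ℚ] bettiCohomology Z k :=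
    (TensorProduct.lid ℚ (bettiCohomology Z k)).symm ≪≫ₗ TensorProduct.congr (LinearEquiv.ofBijective ι.toLinearMap hι) (LinearEquiv.refl ℚ _) with hE
  have hCE : ⇑C.toLinearMap = ⇑E := by
    funext z
    rw [hC, hE, HodgeStructure.Hom.comp_toLinearMap, LinearMap.comp_apply, HodgeStructure.Hom.tensorLidSymm_toLinearMap, HodgeStructure.Hom.tensorMap_toLinearMap,
      HodgeStructure.Hom.id_toLinearMap, LinearEquiv.coe_toLinearMap, TensorProduct.lid_symm_apply, TensorProduct.map_tmul, LinearEquiv.trans_apply, TensorProduct.lid_symm_apply,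
      TensorProduct.congr_tmul, LinearEquiv.refl_apply, LinearEquiv.ofBijective_apply, LinearMap.id_apply]
  refine ⟨{ toLinearMap := C.toLinearMap, map_F_le := fun p ↦ C.map_F_le p }, ?_⟩
  show Function.Bijective ⇑C.toLinearMap
  rw [hCE]
  exact E.bijective

section Pieces

variable [HodgeTensorFacts.{0, 0}] {V₀ : Type} [AddCommGroup V₀] [Module ℚ V₀]

/-- **`dim Hom_HS(H₀, Hᵏ(Y) ⊗ H⁰(Z)) = dim Hom_HS(H₀, Hᵏ(Y))`.** [cite: VoisinHodgeI2002, §11.3.3 Thm. 11.40 and p. 287] [cite: DeligneHodgeII1971, 2.1.13] -/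
theorem BettiUniverse.finrank_hom_right_kunnethSummandFst (hHD : exists_isReal_hodgeModel) (hY : IsSmoothProjective m Y) (hZ : IsSmoothProjective n Z) (k : ℕ)
    (h : (k, (0 : ℕ)) ∈ antidiagonal k) (H₀ : HodgeStructure V₀ (k : ℤ)) :
    Module.finrank ℚ (HodgeStructure.Hom H₀ (BettiUniverse.kunnethSummand hHD hY hZ k ⟨(k, 0), h⟩)) = Module.finrank ℚ (HodgeStructure.Hom H₀ (BettiUniverse.hodge hHD hY k)) := by
  haveI := BettiUniverse.finite hY k
  haveI := BettiUniverse.finite hZ 0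
  obtain ⟨Φ, hΦ⟩ := BettiUniverse.exists_hom_hodge_kunnethSummandFst_bijective hHD hY hZ k h
  exact (Φ.finrank_hom_eq_of_bijective_right hΦ H₀).symm

/-- **`dim Hom_HS(Hᵏ(Y) ⊗ H⁰(Z), H₀) = dim Hom_HS(Hᵏ(Y), H₀)`.** [cite: VoisinHodgeI2002, §11.3.3 Thm. 11.40 and p. 287] [cite: DeligneHodgeII1971, 2.1.13] -/
theorem BettiUniverse.finrank_hom_left_kunnethSummandFst (hHD : exists_isReal_hodgeModel) (hY : IsSmoothProjective m Y) (hZ : IsSmoothProjective n Z) (k : ℕ)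
    (h : (k, (0 : ℕ)) ∈ antidiagonal k) (H₀ : HodgeStructure V₀ (k : ℤ)) :
    Module.finrank ℚ (HodgeStructure.Hom (BettiUniverse.kunnethSummand hHD hY hZ k ⟨(k, 0), h⟩) H₀) = Module.finrank ℚ (HodgeStructure.Hom (BettiUniverse.hodge hHD hY k) H₀) := by
  obtain ⟨Φ, hΦ⟩ := BettiUniverse.exists_hom_hodge_kunnethSummandFst_bijective hHD hY hZ k h
  exact Φ.finrank_hom_eq_of_bijective hΦ H₀

/-- **`dim Hom_HS(H₀, H⁰(Y) ⊗ Hᵏ(Z)) = dim Hom_HS(H₀, Hᵏ(Z))`.** [cite: VoisinHodgeI2002, §11.3.3 Thm. 11.40 and p. 287] [cite: DeligneHodgeII1971, 2.1.13] -/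
theorem BettiUniverse.finrank_hom_right_kunnethSummandSnd (hHD : exists_isReal_hodgeModel) (hY : IsSmoothProjective m Y) (hZ : IsSmoothProjective n Z) (k : ℕ)
    (h : ((0 : ℕ), k) ∈ antidiagonal k) (H₀ : HodgeStructure V₀ (k : ℤ)) :
    Module.finrank ℚ (HodgeStructure.Hom H₀ (BettiUniverse.kunnethSummand hHD hY hZ k ⟨(0, k), h⟩)) = Module.finrank ℚ (HodgeStructure.Hom H₀ (BettiUniverse.hodge hHD hZ k)) := by
  haveI := BettiUniverse.finite hY 0
  haveI := BettiUniverse.finite hZ k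
  obtain ⟨Φ, hΦ⟩ := BettiUniverse.exists_hom_hodge_kunnethSummandSnd_bijective hHD hY hZ k h
  exact (Φ.finrank_hom_eq_of_bijective_right hΦ H₀).symm

/-- **`dim Hom_HS(H⁰(Y) ⊗ Hᵏ(Z), H₀) = dim Hom_HS(Hᵏ(Z), H₀)`.** [cite: VoisinHodgeI2002, §11.3.3 Thm. 11.40 and p. 287] [cite: DeligneHodgeII1971, 2.1.13] -/
theorem BettiUniverse.finrank_hom_left_kunnethSummandSnd (hHD : exists_isReal_hodgeModel) (hY : IsSmoothProjective m Y) (hZ : IsSmoothProjective n Z) (k : ℕ)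
    (h : ((0 : ℕ), k) ∈ antidiagonal k) (H₀ : HodgeStructure V₀ (k : ℤ)) :
    Module.finrank ℚ (HodgeStructure.Hom (BettiUniverse.kunnethSummand hHD hY hZ k ⟨(0, k), h⟩) H₀) = Module.finrank ℚ (HodgeStructure.Hom (BettiUniverse.hodge hHD hZ k) H₀) := by
  obtain ⟨Φ, hΦ⟩ := BettiUniverse.exists_hom_hodge_kunnethSummandSnd_bijective hHD hY hZ k h
  exact Φ.finrank_hom_eq_of_bijective hΦ H₀

end Pieces

/-! ### §2 Degree one: `H¹(Y × Z) ≅ H¹(Y) ⊕ H¹(Z)`, counted through `Hom_HS(H₀, −)` and `Hom_HS(−, H₀)` -/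

section DegreeOne

variable {V₀ : Type} [AddCommGroup V₀] [Module ℚ V₀] [Module.Finite ℚ V₀]

/-- The antidiagonal of `1` is `{(1,0), (0,1)}`: any sum over it is the sum of the two values (private bookkeeping). [folklore] -/
private theorem sum_antidiagonal_one_subtype_eq {M : Type*} [AddCommMonoid M] (f : ↥(antidiagonal 1) → M) (h10 : ((1 : ℕ), (0 : ℕ)) ∈ antidiagonal 1)
    (h01 : ((0 : ℕ), (1 : ℕ)) ∈ antidiagonal 1) : ∑ ij, f ij = f ⟨(1, 0), h10⟩ + f ⟨(0, 1), h01⟩ := by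
  refine Fintype.sum_eq_add (⟨(1, 0), h10⟩ : ↥(antidiagonal 1)) ⟨(0, 1), h01⟩ (fun e ↦ by cases e) ?_
  rintro ⟨⟨i, j⟩, hij⟩ ⟨h₁, h₂⟩
  exfalso
  have hij' : i + j = 1 := HasAntidiagonal.mem_antidiagonal.1 hij
  rcases Nat.eq_zero_or_pos i with rfl | hi
  · obtain rfl : j = 1 := by omega
    exact h₂ rfl
  · obtain rfl : i = 1 := by omega
    obtain rfl : j = 0 := by omega
    exact h₁ rfl

/-- **`dim_ℚ Hom_HS(H₀, H¹(Y × Z)) = dim_ℚ Hom_HS(H₀, H¹(Y)) + dim_ℚ Hom_HS(H₀, H¹(Z))`** for every finite-dimensional `ℚ`-Hodge structure `H₀` of weight one: `H¹(Y × Z) = pr₁^* H¹(Y) ⊕ pr₂^* H¹(Z)`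
is the Künneth decomposition in degree one (Thm. 11.38/11.40 as an isomorphism of Hodge structures, the lane's bijective `kunnethHodgeHom`; end pieces §1), and `Hom_HS(H₀, −)` is additive (Deligne
2.1; p34's `finrank_hom_pi_right_eq_sum`). [cite: VoisinHodgeI2002, §11.3.3 Thm. 11.38, Thm. 11.40 and p. 287] [cite: DeligneHodgeII1971, 2.1] -/
theorem BettiUniverse.finrank_hom_right_hodge_one_tensor (hHD : exists_isReal_hodgeModel) (hY : IsSmoothProjective m Y) (hZ : IsSmoothProjective n Z) (hYZ : IsSmoothProjective d (Y ⊗ Z))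
    (H₀ : HodgeStructure V₀ ((1 : ℕ) : ℤ)) :
    Module.finrank ℚ (HodgeStructure.Hom H₀ (BettiUniverse.hodge hHD hYZ 1)) =
      Module.finrank ℚ (HodgeStructure.Hom H₀ (BettiUniverse.hodge hHD hY 1)) + Module.finrank ℚ (HodgeStructure.Hom H₀ (BettiUniverse.hodge hHD hZ 1)) := by
  haveI : HodgeTensorFacts.{0, 0} := hodgeTensorFacts_holds
  haveI := fun i ↦ BettiUniverse.finite hY i
  haveI := fun j ↦ BettiUniverse.finite hZ j
  haveI := BettiUniverse.finite hYZ 1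
  have h10 : ((1 : ℕ), (0 : ℕ)) ∈ antidiagonal 1 := HasAntidiagonal.mem_antidiagonal.2 rfl
  have h01 : ((0 : ℕ), (1 : ℕ)) ∈ antidiagonal 1 := HasAntidiagonal.mem_antidiagonal.2 rfl
  rw [← (BettiUniverse.kunnethHodgeHom hHD hodgePQ_independent_of_hodgeModel_holds hY hZ hYZ 1).finrank_hom_eq_of_bijective_right
      (by rw [BettiUniverse.kunnethHodgeHom_toLinearMap]; exact BettiUniverse.kunnethMap_bijective hY hZ 1) H₀,
    finrank_hom_pi_right_eq_sum, sum_antidiagonal_one_subtype_eq _ h10 h01, BettiUniverse.finrank_hom_right_kunnethSummandFst hHD hY hZ 1 h10 H₀,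
    BettiUniverse.finrank_hom_right_kunnethSummandSnd hHD hY hZ 1 h01 H₀]

/-- **`dim_ℚ Hom_HS(H¹(Y × Z), H₀) = dim_ℚ Hom_HS(H¹(Y), H₀) + dim_ℚ Hom_HS(H¹(Z), H₀)`** for every finite-dimensional `ℚ`-Hodge structure `H₀` of weight one (`Hom_HS(−, H₀)` is additive, p34's
`finrank_hom_pi_eq_sum`). [cite: VoisinHodgeI2002, §11.3.3 Thm. 11.38, Thm. 11.40 and p. 287] [cite: DeligneHodgeII1971, 2.1] -/
theorem BettiUniverse.finrank_hom_left_hodge_one_tensor (hHD : exists_isReal_hodgeModel) (hY : IsSmoothProjective m Y) (hZ : IsSmoothProjective n Z) (hYZ : IsSmoothProjective d (Y ⊗ Z))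
    (H₀ : HodgeStructure V₀ ((1 : ℕ) : ℤ)) :
    Module.finrank ℚ (HodgeStructure.Hom (BettiUniverse.hodge hHD hYZ 1) H₀) =
      Module.finrank ℚ (HodgeStructure.Hom (BettiUniverse.hodge hHD hY 1) H₀) + Module.finrank ℚ (HodgeStructure.Hom (BettiUniverse.hodge hHD hZ 1) H₀) := by
  haveI : HodgeTensorFacts.{0, 0} := hodgeTensorFacts_holds
  haveI := fun i ↦ BettiUniverse.finite hY i
  haveI := fun j ↦ BettiUniverse.finite hZ j
  haveI := BettiUniverse.finite hYZ 1
  have h10 : ((1 : ℕ), (0 : ℕ)) ∈ antidiagonal 1 := HasAntidiagonal.mem_antidiagonal.2 rfl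
  have h01 : ((0 : ℕ), (1 : ℕ)) ∈ antidiagonal 1 := HasAntidiagonal.mem_antidiagonal.2 rfl
  rw [(BettiUniverse.kunnethHodgeHom hHD hodgePQ_independent_of_hodgeModel_holds hY hZ hYZ 1).finrank_hom_eq_of_bijective
      (by rw [BettiUniverse.kunnethHodgeHom_toLinearMap]; exact BettiUniverse.kunnethMap_bijective hY hZ 1) H₀,
    finrank_hom_pi_eq_sum, sum_antidiagonal_one_subtype_eq _ h10 h01, BettiUniverse.finrank_hom_left_kunnethSummandFst hHD hY hZ 1 h10 H₀,
    BettiUniverse.finrank_hom_left_kunnethSummandSnd hHD hY hZ 1 h01 H₀]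

end DegreeOne

/-- **`dim_ℚ Hom_HS(H¹(W), H¹(Y × Z)) = dim_ℚ Hom_HS(H¹(W), H¹(Y)) + dim_ℚ Hom_HS(H¹(W), H¹(Z))`.** [cite: VoisinHodgeI2002, §11.3.3 Thm. 11.40, Lemma 11.41 and p. 287] [cite: DeligneHodgeII1971, 2.1] -/
theorem BettiUniverse.finrank_hom_hodge_one_hodge_one_tensor (hHD : exists_isReal_hodgeModel) (hW : IsSmoothProjective l W) (hY : IsSmoothProjective m Y) (hZ : IsSmoothProjective n Z)
    (hYZ : IsSmoothProjective d (Y ⊗ Z)) :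
    Module.finrank ℚ (HodgeStructure.Hom (BettiUniverse.hodge hHD hW 1) (BettiUniverse.hodge hHD hYZ 1)) =
      Module.finrank ℚ (HodgeStructure.Hom (BettiUniverse.hodge hHD hW 1) (BettiUniverse.hodge hHD hY 1)) +
        Module.finrank ℚ (HodgeStructure.Hom (BettiUniverse.hodge hHD hW 1) (BettiUniverse.hodge hHD hZ 1)) := by
  haveI := BettiUniverse.finite hW 1
  exact BettiUniverse.finrank_hom_right_hodge_one_tensor hHD hY hZ hYZ _

/-- **`dim_ℚ Hom_HS(H¹(Y × Z), H¹(W)) = dim_ℚ Hom_HS(H¹(Y), H¹(W)) + dim_ℚ Hom_HS(H¹(Z), H¹(W))`.** [cite: VoisinHodgeI2002, §11.3.3 Thm. 11.40, Lemma 11.41 and p. 287] [cite: DeligneHodgeII1971, 2.1] -/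
theorem BettiUniverse.finrank_hom_hodge_one_tensor_hodge_one (hHD : exists_isReal_hodgeModel) (hY : IsSmoothProjective m Y) (hZ : IsSmoothProjective n Z) (hYZ : IsSmoothProjective d (Y ⊗ Z))
    (hW : IsSmoothProjective l W) :
    Module.finrank ℚ (HodgeStructure.Hom (BettiUniverse.hodge hHD hYZ 1) (BettiUniverse.hodge hHD hW 1)) =
      Module.finrank ℚ (HodgeStructure.Hom (BettiUniverse.hodge hHD hY 1) (BettiUniverse.hodge hHD hW 1)) +
        Module.finrank ℚ (HodgeStructure.Hom (BettiUniverse.hodge hHD hZ 1) (BettiUniverse.hodge hHD hW 1)) := by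
  haveI := BettiUniverse.finite hW 1
  exact BettiUniverse.finrank_hom_left_hodge_one_tensor hHD hY hZ hYZ _

/-! ### §3 Picard numbers of triple products and of self powers -/

/-- **`ρ((Y × Z) × W) = ρ(Y) + ρ(Z) + ρ(W) + dim Hom_HS(H¹Y, H¹Z) + dim Hom_HS(H¹Y, H¹W) + dim Hom_HS(H¹Z, H¹W)`** (any smooth-projective structures on the products): the two-factor formula
`ρ(Y × Z) = ρ(Y) + ρ(Z) + dim Hom_HS(H¹(Y), H¹(Z))` (Lemma 11.41 counted, g27-#7) twice, and `Hom_HS(H¹(Y × Z), H¹(W)) = Hom_HS(H¹Y, H¹W) ⊕ Hom_HS(H¹Z, H¹W)` (§2).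
[cite: VoisinHodgeI2002, §11.3.3 Thm. 11.38, Lemma 11.41 (p. 286) and p. 287] [cite: HulekLaface2019PicardNumbersAV, §2.1 Prop. 2.2 and Cor. 2.3] -/
theorem BettiUniverse.picardNumber_tensor_tensor (hHD : exists_isReal_hodgeModel) (hY : IsSmoothProjective m Y) (hZ : IsSmoothProjective n Z) (hW : IsSmoothProjective l W) {d₁ : ℕ}
    (hYZ : IsSmoothProjective d₁ (Y ⊗ Z)) (hYZW : IsSmoothProjective d ((Y ⊗ Z) ⊗ W)) :
    Module.finrank ℚ ↥((BettiUniverse.hodge hHD hYZW 2).hodgeClasses 1) =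
      Module.finrank ℚ ↥((BettiUniverse.hodge hHD hY 2).hodgeClasses 1) + Module.finrank ℚ ↥((BettiUniverse.hodge hHD hZ 2).hodgeClasses 1) +
          Module.finrank ℚ ↥((BettiUniverse.hodge hHD hW 2).hodgeClasses 1) +
        (Module.finrank ℚ (HodgeStructure.Hom (BettiUniverse.hodge hHD hY 1) (BettiUniverse.hodge hHD hZ 1)) +
          Module.finrank ℚ (HodgeStructure.Hom (BettiUniverse.hodge hHD hY 1) (BettiUniverse.hodge hHD hW 1)) +
            Module.finrank ℚ (HodgeStructure.Hom (BettiUniverse.hodge hHD hZ 1) (BettiUniverse.hodge hHD hW 1))) := by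
  haveI : HodgeTensorFacts.{0, 0} := hodgeTensorFacts_holds
  rw [BettiUniverse.picardNumber_tensor_eq_add_finrank_hom hHD hYZ hW hYZW, BettiUniverse.picardNumber_tensor_eq_add_finrank_hom hHD hY hZ hYZ,
    BettiUniverse.finrank_hom_hodge_one_tensor_hodge_one hHD hY hZ hYZ hW]
  ring

section Powers

variable {V₀ : Type} [AddCommGroup V₀] [Module ℚ V₀] [Module.Finite ℚ V₀]

/-- **`dim_ℚ Hom_HS(H₀, H¹(X^{m+1})) = (m+1)·dim_ℚ Hom_HS(H₀, H¹(X))`** (`H¹(X^{m+1}) = ⊕ prᵢ^* H¹(X)`; any smooth-projective witness of the power `powObj X m`).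
[cite: VoisinHodgeI2002, §11.3.3 Thm. 11.38 and p. 287] [cite: DeligneHodgeII1971, 2.1] -/
theorem BettiUniverse.finrank_hom_right_hodge_one_powObj (hHD : exists_isReal_hodgeModel) (hX : IsSmoothProjective n X) (H₀ : HodgeStructure V₀ ((1 : ℕ) : ℤ)) :
    ∀ (m : ℕ) {d : ℕ} (h : IsSmoothProjective d (powObj X m)),
      Module.finrank ℚ (HodgeStructure.Hom H₀ (BettiUniverse.hodge hHD h 1)) = (m + 1) * Module.finrank ℚ (HodgeStructure.Hom H₀ (BettiUniverse.hodge hHD hX 1))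
  | 0, d, h => by
    obtain rfl : d = n := IsSmoothProjective.dim_unique (X := X) h hX
    rw [zero_add, one_mul]
    rfl
  | m + 1, d, h => by
    have hP := isSmoothProjective_powObj hX m
    have e := BettiUniverse.finrank_hom_right_hodge_one_tensor hHD hX hP (h : IsSmoothProjective d (X ⊗ powObj X m)) H₀
    rw [BettiUniverse.finrank_hom_right_hodge_one_powObj hHD hX H₀ m hP] at e
    refine e.trans ?_
    push_cast
    ring

/-- **`dim_ℚ Hom_HS(H¹(X^{m+1}), H₀) = (m+1)·dim_ℚ Hom_HS(H¹(X), H₀)`.** [cite: VoisinHodgeI2002, §11.3.3 Thm. 11.38 and p. 287] [cite: DeligneHodgeII1971, 2.1] -/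
theorem BettiUniverse.finrank_hom_left_hodge_one_powObj (hHD : exists_isReal_hodgeModel) (hX : IsSmoothProjective n X) (H₀ : HodgeStructure V₀ ((1 : ℕ) : ℤ)) :
    ∀ (m : ℕ) {d : ℕ} (h : IsSmoothProjective d (powObj X m)),
      Module.finrank ℚ (HodgeStructure.Hom (BettiUniverse.hodge hHD h 1) H₀) = (m + 1) * Module.finrank ℚ (HodgeStructure.Hom (BettiUniverse.hodge hHD hX 1) H₀)
  | 0, d, h => by
    obtain rfl : d = n := IsSmoothProjective.dim_unique (X := X) h hX
    rw [zero_add, one_mul]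
    rfl
  | m + 1, d, h => by
    have hP := isSmoothProjective_powObj hX m
    have e := BettiUniverse.finrank_hom_left_hodge_one_tensor hHD hX hP (h : IsSmoothProjective d (X ⊗ powObj X m)) H₀
    rw [BettiUniverse.finrank_hom_left_hodge_one_powObj hHD hX H₀ m hP] at e
    refine e.trans ?_
    push_cast
    ring

end Powers

/-- **`dim_ℚ End_HS(H¹(X^{m+1})) = (m+1)²·dim_ℚ End_HS(H¹(X))`** (`End(H^{⊕k}) = M_k(End H)`). [cite: Lange2023AbelianVarietiesComplex, §2.4.4 Cor. 2.4.26 (proof)] [cite: DeligneHodgeII1971, 2.1] -/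
theorem BettiUniverse.finrank_end_hodge_one_powObj (hHD : exists_isReal_hodgeModel) (hX : IsSmoothProjective n X) (m : ℕ) {d : ℕ} (h : IsSmoothProjective d (powObj X m)) :
    Module.finrank ℚ (HodgeStructure.Hom (BettiUniverse.hodge hHD h 1) (BettiUniverse.hodge hHD h 1)) =
      (m + 1) ^ 2 * Module.finrank ℚ (HodgeStructure.Hom (BettiUniverse.hodge hHD hX 1) (BettiUniverse.hodge hHD hX 1)) := by
  haveI := BettiUniverse.finite h 1
  haveI := BettiUniverse.finite hX 1
  rw [BettiUniverse.finrank_hom_left_hodge_one_powObj hHD hX _ m h, BettiUniverse.finrank_hom_right_hodge_one_powObj hHD hX _ m h]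
  ring

/-- **`ρ(X^{m+1}) = (m+1)·ρ(X) + C(m+1, 2)·dim_ℚ End_HS(H¹(X))`** for every smooth projective `X` (any smooth-projective witness of `X^{m+1} = powObj X m`): induction on `m` through
`ρ(X × X^{m}) = ρ(X) + ρ(X^{m}) + dim Hom_HS(H¹(X), H¹(X^{m}))` and `Hom_HS(H¹(X), H¹(X^{m})) = End_HS(H¹(X))^{m}` — the uniform form of Murty's Lemma 3.3 / Hulek–Laface Prop. 2.4
(`ρ(A^k) = k·ρ(A) + C(k, 2)·rk End(A)`; for a non-CM elliptic curve `k(k+1)/2`, with CM `k²`). [cite: HulekLaface2019PicardNumbersAV, §2.1 Cor. 2.3 and §2.2 Prop. 2.4 (= Murty 1984 Lemma 3.3)]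
[cite: VoisinHodgeI2002, §11.3.3 Lemma 11.41 (p. 286) and p. 287] -/
theorem BettiUniverse.picardNumber_powObj (hHD : exists_isReal_hodgeModel) (hX : IsSmoothProjective n X) :
    ∀ (m : ℕ) {d : ℕ} (h : IsSmoothProjective d (powObj X m)),
      Module.finrank ℚ ↥((BettiUniverse.hodge hHD h 2).hodgeClasses 1) =
        (m + 1) * Module.finrank ℚ ↥((BettiUniverse.hodge hHD hX 2).hodgeClasses 1) +
          (m + 1).choose 2 * Module.finrank ℚ (HodgeStructure.Hom (BettiUniverse.hodge hHD hX 1) (BettiUniverse.hodge hHD hX 1))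
  | 0, d, h => by
    obtain rfl : d = n := IsSmoothProjective.dim_unique (X := X) h hX
    rw [zero_add, one_mul, Nat.choose_succ_self, zero_mul, add_zero]
    rfl
  | m + 1, d, h => by
    haveI : HodgeTensorFacts.{0, 0} := hodgeTensorFacts_holds
    haveI := BettiUniverse.finite hX 1
    have hP := isSmoothProjective_powObj hX m
    have e := BettiUniverse.picardNumber_tensor_eq_add_finrank_hom hHD hX hP (h : IsSmoothProjective d (X ⊗ powObj X m))
    rw [BettiUniverse.picardNumber_powObj hHD hX m hP, BettiUniverse.finrank_hom_right_hodge_one_powObj hHD hX _ m hP] at e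
    refine e.trans ?_
    have h2 : (m + 1 + 1).choose 2 = (m + 1) + (m + 1).choose 2 := by simpa [Nat.choose_one_right] using Nat.choose_succ_succ (m + 1) 1
    rw [h2]
    push_cast
    ring

/-- **Curves: `ρ(C^{m+1}) = (m+1) + C(m+1, 2)·dim_ℚ End_HS(H¹(C))`** (`= (m+1) + C(m+1,2)·rk End(J(C))`; `m = 1`: `ρ(C × C) = 2 + rk End(J(C))`).
[cite: Arapura2012, §11.1 Example 11.1.2 (PDF p. 174)] [cite: HulekLaface2019PicardNumbersAV, §2.2 Prop. 2.4 and the display `ρ(E^k)`] -/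
theorem BettiUniverse.picardNumber_powObj_curve (hHD : exists_isReal_hodgeModel) {C : SchemeOver ℂ} (hC : IsSmoothProjective 1 C) (m : ℕ) {d : ℕ} (h : IsSmoothProjective d (powObj C m)) :
    Module.finrank ℚ ↥((BettiUniverse.hodge hHD h 2).hodgeClasses 1) =
      (m + 1) + (m + 1).choose 2 * Module.finrank ℚ (HodgeStructure.Hom (BettiUniverse.hodge hHD hC 1) (BettiUniverse.hodge hHD hC 1)) := by
  rw [BettiUniverse.picardNumber_powObj hHD hC m h, BettiUniverse.picardNumber_curve hHD hC, mul_one]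

/-! ### §4 Abelian varieties: `rk Hom` is additive over products, `ρ(A × A' × A'')`, `ρ(A^{m+1}) = (m+1)ρ(A) + C(m+1,2)·rk End(A)`, `C(m+2,2) ≤ ρ(E^{m+1}) ≤ (m+1)²` -/

section AbelianVarieties

variable (A A' B : Motives.AbelianVariety ℂ)

/-- **`rk_ℤ Hom(B, A × A') = rk_ℤ Hom(B, A) + rk_ℤ Hom(B, A')`**, read Hodge-theoretically: `rk Hom(B, A × A') = dim Hom_HS(H¹(A × A'), H¹(B))` (Riemann, g28-#5) and `H¹(A × A') = H¹(A) ⊕ H¹(A')` (§2)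
(the tree's algebraic count is `Motives.AbelianVariety.finrank_hom_biprod`). [cite: DeligneMilne1982Tannakian, II §6 Thm. 6.20 (Riemann), p. 212] [cite: Lange2023AbelianVarietiesComplex, §2.4.4 Cor. 2.4.26 (proof)] -/
theorem AbelianVariety.finrank_hom_prod_right_eq_add : Module.finrank ℤ (B ⟶ A.prod A') = Module.finrank ℤ (B ⟶ A) + Module.finrank ℤ (B ⟶ A') := by
  have hHD := exists_isReal_hodgeModel_holds
  have hA : IsSmoothProjective A.dim A.X := Motives.AbelianVariety.isSmoothProjective_holds
  have hA' : IsSmoothProjective A'.dim A'.X := Motives.AbelianVariety.isSmoothProjective_holds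
  have hB : IsSmoothProjective B.dim B.X := Motives.AbelianVariety.isSmoothProjective_holds
  have hP : IsSmoothProjective (A.prod A').dim (A.X ⊗ A'.X) := Motives.AbelianVariety.isSmoothProjective_holds (A := A.prod A')
  rw [← BettiUniverse.finrank_hom_hodge_one_abelianVariety_eq (A.prod A') B hHD hP hB, ← BettiUniverse.finrank_hom_hodge_one_abelianVariety_eq A B hHD hA hB,
    ← BettiUniverse.finrank_hom_hodge_one_abelianVariety_eq A' B hHD hA' hB]
  exact BettiUniverse.finrank_hom_hodge_one_tensor_hodge_one hHD hA hA' hP hB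

/-- **`rk_ℤ Hom(A × A', B) = rk_ℤ Hom(A, B) + rk_ℤ Hom(A', B)`**, read Hodge-theoretically (`= dim Hom_HS(H¹(B), H¹(A × A'))`). [cite: DeligneMilne1982Tannakian, II §6 Thm. 6.20 (Riemann), p. 212]
[cite: Lange2023AbelianVarietiesComplex, §2.4.4 Cor. 2.4.26 (proof)] -/
theorem AbelianVariety.finrank_hom_prod_left_eq_add : Module.finrank ℤ (A.prod A' ⟶ B) = Module.finrank ℤ (A ⟶ B) + Module.finrank ℤ (A' ⟶ B) := by
  have hHD := exists_isReal_hodgeModel_holds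
  have hA : IsSmoothProjective A.dim A.X := Motives.AbelianVariety.isSmoothProjective_holds
  have hA' : IsSmoothProjective A'.dim A'.X := Motives.AbelianVariety.isSmoothProjective_holds
  have hB : IsSmoothProjective B.dim B.X := Motives.AbelianVariety.isSmoothProjective_holds
  have hP : IsSmoothProjective (A.prod A').dim (A.X ⊗ A'.X) := Motives.AbelianVariety.isSmoothProjective_holds (A := A.prod A')
  rw [← BettiUniverse.finrank_hom_hodge_one_abelianVariety_eq B (A.prod A') hHD hB hP, ← BettiUniverse.finrank_hom_hodge_one_abelianVariety_eq B A hHD hB hA,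
    ← BettiUniverse.finrank_hom_hodge_one_abelianVariety_eq B A' hHD hB hA']
  exact BettiUniverse.finrank_hom_hodge_one_hodge_one_tensor hHD hB hA hA' hP

variable (A'' : Motives.AbelianVariety ℂ)

/-- **`ρ(A × A' × A'') = ρ(A) + ρ(A') + ρ(A'') + rk Hom(A', A) + rk Hom(A'', A) + rk Hom(A'', A')`** (any smooth-projective structures on the products).
[cite: HulekLaface2019PicardNumbersAV, §2.1 Prop. 2.2 and Cor. 2.3] [cite: DeligneMilne1982Tannakian, II §6 Thm. 6.20 (Riemann), p. 212] -/
theorem BettiUniverse.picardNumber_tensor_tensor_abelianVarieties (hHD : exists_isReal_hodgeModel) (hA : IsSmoothProjective A.dim A.X) (hA' : IsSmoothProjective A'.dim A'.X)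
    (hA'' : IsSmoothProjective A''.dim A''.X) {d₁ : ℕ} (hAA' : IsSmoothProjective d₁ (A.X ⊗ A'.X)) (hAAA : IsSmoothProjective d ((A.X ⊗ A'.X) ⊗ A''.X)) :
    Module.finrank ℚ ↥((BettiUniverse.hodge hHD hAAA 2).hodgeClasses 1) =
      Module.finrank ℚ ↥((BettiUniverse.hodge hHD hA 2).hodgeClasses 1) + Module.finrank ℚ ↥((BettiUniverse.hodge hHD hA' 2).hodgeClasses 1) +
          Module.finrank ℚ ↥((BettiUniverse.hodge hHD hA'' 2).hodgeClasses 1) +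
        (Module.finrank ℤ (A' ⟶ A) + Module.finrank ℤ (A'' ⟶ A) + Module.finrank ℤ (A'' ⟶ A')) := by
  rw [BettiUniverse.picardNumber_tensor_tensor hHD hA hA' hA'' hAA' hAAA, BettiUniverse.finrank_hom_hodge_one_abelianVariety_eq A A' hHD hA hA',
    BettiUniverse.finrank_hom_hodge_one_abelianVariety_eq A A'' hHD hA hA'', BettiUniverse.finrank_hom_hodge_one_abelianVariety_eq A' A'' hHD hA' hA'']

/-- **`ρ(A^{m+1}) = (m+1)·ρ(A) + C(m+1, 2)·rk_ℤ End(A)`** (Murty's Lemma 3.3 / Hulek–Laface Prop. 2.4 in uniform form: in the four Albert types `½ek(k+1)`, `ek(2k+1)`, `ek(2k−1)`, `½ed²k²` with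
`k = m+1`), for the power `powObj A.X m` with any smooth-projective witness. [cite: HulekLaface2019PicardNumbersAV, §2.1 Cor. 2.3 and §2.2 Prop. 2.4 (= Murty 1984 Lemma 3.3)]
[cite: DeligneMilne1982Tannakian, II §6 Thm. 6.20 (Riemann), p. 212] -/
theorem BettiUniverse.picardNumber_powObj_abelianVariety (hHD : exists_isReal_hodgeModel) (hA : IsSmoothProjective A.dim A.X) (m : ℕ) {d : ℕ} (h : IsSmoothProjective d (powObj A.X m)) :
    Module.finrank ℚ ↥((BettiUniverse.hodge hHD h 2).hodgeClasses 1) =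
      (m + 1) * Module.finrank ℚ ↥((BettiUniverse.hodge hHD hA 2).hodgeClasses 1) + (m + 1).choose 2 * Module.finrank ℤ (A ⟶ A) := by
  rw [BettiUniverse.picardNumber_powObj hHD hA m h, BettiUniverse.finrank_hom_hodge_one_abelianVariety_self_eq A hHD hA]

/-- **Elliptic curves: `ρ(E^{m+1}) = (m+1) + C(m+1, 2)·rk_ℤ End(E)`** (`dim E = 1`, `ρ(E) = 1`). [cite: HulekLaface2019PicardNumbersAV, §2.2 after Cor. 2.5 (the display `ρ(E^k)`)]
[cite: Arapura2012, §11.1 Example 11.1.2 (PDF p. 174)] -/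
theorem BettiUniverse.picardNumber_powObj_ellipticCurve (hHD : exists_isReal_hodgeModel) (hA : IsSmoothProjective A.dim A.X) (hg : A.dim = 1) (m : ℕ) {d : ℕ}
    (h : IsSmoothProjective d (powObj A.X m)) :
    Module.finrank ℚ ↥((BettiUniverse.hodge hHD h 2).hodgeClasses 1) = (m + 1) + (m + 1).choose 2 * Module.finrank ℤ (A ⟶ A) := by
  have h₁ := (BettiUniverse.finrank_hodgeClasses_hodge_two_abelianVariety_le_sq A hHD hA).trans_eq (show A.dim ^ 2 = 1 by rw [hg, one_pow])
  have h₂ := BettiUniverse.one_le_finrank_hodgeClasses_hodge_two_abelianVariety A hHD hA (by omega)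
  rw [BettiUniverse.picardNumber_powObj_abelianVariety A hHD hA m h, le_antisymm h₁ h₂, mul_one]

/-- **`C(m+2, 2) ≤ ρ(E^{m+1})`** for an elliptic curve (`rk End(E) ≥ 1`; equality `ρ(E^k) = k(k+1)/2` is the non-CM case). [cite: HulekLaface2019PicardNumbersAV, §2.2 after Cor. 2.5 (the display `ρ(E^k)`)] -/
theorem BettiUniverse.choose_le_picardNumber_powObj_ellipticCurve (hHD : exists_isReal_hodgeModel) (hA : IsSmoothProjective A.dim A.X) (hg : A.dim = 1) (m : ℕ) {d : ℕ}
    (h : IsSmoothProjective d (powObj A.X m)) : (m + 2).choose 2 ≤ Module.finrank ℚ ↥((BettiUniverse.hodge hHD h 2).hodgeClasses 1) := by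
  rw [BettiUniverse.picardNumber_powObj_ellipticCurve A hHD hA hg m h]
  have hE := Motives.AbelianVariety.finrank_end_pos (B := A) (by omega)
  have h2 : (m + 2).choose 2 = (m + 1) + (m + 1).choose 2 := by simpa [Nat.choose_one_right] using Nat.choose_succ_succ (m + 1) 1
  rw [h2]
  nlinarith

/-- **`ρ(E^{m+1}) ≤ (m+1)²`** for an elliptic curve (`rk End(E) ≤ 2`; equality `ρ(E^k) = k²` is the CM case). [cite: HulekLaface2019PicardNumbersAV, §2.2 after Cor. 2.5 (the display `ρ(E^k)`)]
[cite: Lange2023AbelianVarietiesComplex, §1.1.2 Prop. 1.1.8 (PDF p. 20)] -/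
theorem BettiUniverse.picardNumber_powObj_ellipticCurve_le_sq (hHD : exists_isReal_hodgeModel) (hA : IsSmoothProjective A.dim A.X) (hg : A.dim = 1) (m : ℕ) {d : ℕ}
    (h : IsSmoothProjective d (powObj A.X m)) : Module.finrank ℚ ↥((BettiUniverse.hodge hHD h 2).hodgeClasses 1) ≤ (m + 1) ^ 2 := by
  rw [BettiUniverse.picardNumber_powObj_ellipticCurve A hHD hA hg m h]
  have hE := (AbelianVariety.finrank_end_le_two_mul_dim_sq A).trans_eq (show 2 * A.dim ^ 2 = 2 by rw [hg, one_pow, mul_one])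
  have h3 : (m + 1) * m = (m + 1).choose 2 * 2 := by simpa [Nat.choose_one_right] using Nat.add_one_mul_choose_eq m 1
  nlinarith

end AbelianVarieties

end Literature.AlgebraicGeometry.HodgeTheory

end
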